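import Summits.SmoothPoincare4.SmoothPoincare4.Theses.ConvexBisection
import Summits.SmoothPoincare4.SmoothPoincare4.Theorems.ConvexBisectionAcyclicBisectionRigidityStubUnfoldedSphere
import Summits.SmoothPoincare4.SmoothPoincare4.Theorems.ConvexBisectionAcyclicBisectionRigidityStubGenusOneDet
import Summits.SmoothPoincare4.SmoothPoincare4.Theorems.ConvexBisectionAcyclicBisectionRigidityStubMatsumotoNormalForm
import Summits.SmoothPoincare4.SmoothPoincare4.Theorems.ConvexBisectionAcyclicBisectionRigidityStubMatsumotoNormalFormAux8
import Summits.SmoothPoincare4.SmoothPoincare4.Theorems.ConvexBisectionAcyclicBisectionRigidityFoldCertificates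
import Summits.SmoothPoincare4.SmoothPoincare4.Theorems.ConvexBisectionAcyclicBisectionExistsStubExchange
import Summits.SmoothPoincare4.SmoothPoincare4.Theorems.ConvexBisectionAcyclicBisectionExistsStubSortBiSpan
import Summits.SmoothPoincare4.SmoothPoincare4.Theorems.ConvexBisectionAcyclicBisectionExistsStubReductionLift
import Summits.SmoothPoincare4.SmoothPoincare4.Theorems.ConvexBisectionAcyclicBisectionExistsStubReachInvariants
import Summits.SmoothPoincare4.SmoothPoincare4.Theorems.ConvexBisectionAcyclicBisectionExistsStubSortedModelOf
import Literature.Topology.FourManifolds.LefschetzHandlebody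
import Literature.Topology.FourManifolds.LefschetzModelFacts
import Literature.Topology.FourManifolds.HomotopyS4CompactProofs
import Literature.Topology.FourManifolds.CerfGammaFour
import Literature.GroupTheory.CombinatorialGroupTheory.SignedHurwitzAction
import Literature.GroupTheory.CombinatorialGroupTheory.SignedHurwitzStabilisation
import Literature.GroupTheory.CombinatorialGroupTheory.SignedHurwitzReach
import HarnessLib

/-!
# Line `folded-curve-branch-locus` for crux `ConvexBisection.AcyclicBisectionRigidity`
(item stmt-SmoothPoincare4-10507, route `route-SmoothPoincare4-ConvexBisection`, rank 2)

**LEAD a4, RESHAPE s3 (2026-08-17; registered stubs = the `stub_*` theorems carrying `sorry` below).**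
Wave 1 of this lead changed the line in four places, all recorded in NOTES/PICKED of the lead's folder
and in the crux item's evidence:
* Stub C LANDED (worker C, p134910 `Theorems/ConvexBisectionAcyclicBisectionRigidityStubUnfoldedSphere.lean`,
  with Aux p132915 / Aux2 p134180: `Base 0 ≅ 𝔻⁴` by a Morse perturbation of `rho 0` and the tree's Milnor disc
  theorem, the empty multi-attachment, gluing transport, Cerf as hypothesis) — `stub_unfoldedSphere` below is
  now a one-line alias of the landed theorem; its only debt is the fact stub `stub_factCerf`.
* Stub A REPLACED by a PROVED theorem `foldedNormalForm_of_facts` (worker A's finding, re-derived here for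
  `M ≃ₕ S⁴`): the four NAMED FACTS of the Lefschetz dictionary of crux 10508 (`modelsOnFibred_exists`,
  `modelsOn_counts_of_homotopyEquiv_sphere`, `modelsOnFibred_balance_of_homotopyEquiv_sphere`,
  `modelsOnFibred_of_reach`; fact stub `stub_factLefschetz`) and the LANDED algebra of line `modp-braid-orbits`
  (`stub_exchange`, `stub_reachInvariants`, `stub_sortBiSpan`, `hurwitzOrbit_lift`) give EVERY homotopy
  4-sphere a sorted allowable balanced bi-spanning fibred model.  The briefed Giroux route of Stub A cannot be
  STATED today (audit: the boundary open book of a Lefschetz handlebody is not a tree notion) and — decisive —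
  its conclusion forgets the bisection anyway, so the composition below no longer consumes the crux's
  hypothesis: THIS LINE IS A PROOF SCHEME FOR SPC4 ITSELF, graded by fold genus, and its apex Stub B is
  SPC4-EQUIVALENT modulo the four facts and the two low rungs (`spc4_iff_foldRecognition_of_facts`,
  `spc4_of_higherGenusFold_of_facts` below, sorry-free).  That is the lead's certificate that
  `stub_higherGenusFold` is summit-sized (promote-stub / line verdict material), not a claim of progress on it.
* Stub D RESHAPED after worker D's census (evidence `genus1_census.md`, exact for d ≤ 1000): genus 1 is a
  THEOREM ON PAPER — Matsumoto 1985 (J. Math. Soc. Japan 37, Thm. 3.2): every 4-letter word of primitive signed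
  transvections with trivial product is signed-Hurwitz-equivalent to `((u,η),(u,¬η),(w,η′),(w,¬η′))`; a
  homotopy sphere forces `|u×w| = 1`; that model is `B⁴ ∪_φ B⁴` by four geometric cancellations, hence `S⁴`
  by Cerf.  So `stub_genusOneFold` is now PROVED below from four smaller registered stubs — `stub_genusOnePrimitive`
  (dictionary: page curves with non-zero shadow are primitive), `stub_matsumotoNormalForm` (PURE ALGEBRA over
  `SignedHurwitz`, formalisable now), `stub_genusOneDet` (`H₁`: `|u×w| = 1`), `stub_genusOneTopRecognition`
  (the four cancellations + Cerf, unshielded, same shape as Stub C) — and the two fact stubs.  The brief's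
  recognition criterion (G1) was wrong (corrected determinant criterion holds exactly at Fibonacci d and is
  not needed); Orevkov/Mazur/LP are not needed in genus 1.
* Stub B unchanged (held by the lead): see the certificate section at the end.

**RESHAPE s4 (2026-08-17, after wave 2).**  D-det LANDED as registered (worker, p136292
`…StubGenusOneDet.lean`: integral excision + Lefschetz duality over the concrete `Base 1`, NF5, `ℤu + ℤw = ℤ²
⇒ u × w = ±1`).  D-alg as registered was FALSE — refuted in the tree (`helper_matsumotoNormalForm_exact_false`,
p139060: `[(e₁,+),(−e₁,+),(e₁,−),(e₁,−)]` has primitive letters and trivial product but no EXACTLY-signed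
normal form in its orbit, since letters carry oriented classes while `T_{(−v,ε)} = T_{(v,ε)}`) — and its
correct form is PROVED and LANDED: `helper_matsumotoNormalForm_pm` (p139869, + Aux p138431/p138443/p138754/
p138772/p139242: classes up to sign `u' = ±u`, `w' = ±w`, hypothesis "two letters of each sign", proof by
descent on `Σ_{i<j} |ω(vᵢ,vⱼ)|` with Vieta-jumping inequalities, not Matsumoto's `PSL₂(ℤ)` length) together
with the sign-fixing step `helper_normalForm_signs` (p140301/p140325: with `|ω(u,w)| = 1` an exactly-signed
normal form IS reached in ≤ 6 moves).  So in this file D-alg and D-det are now theorems, the ±-variant of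
D-det is proved here from the landed helpers, and `stub_genusOneFold` is proved from the two REMAINING
genus-1 stubs D-prim (`stub_genusOnePrimitive`: blocked on one surface-topology fact, "a simple closed page
curve with non-zero class is primitive", absent from the tree; conditional proof kernel-checked by the worker)
and D-top (`stub_genusOneTopRecognition`: blocked first on a handle decomposition of the concrete `Base 1`,
audit `stub_genusOneTopRecognition_AUDIT.md`), plus the two fact stubs.  Five `sorry`s remain: the two fact
stubs, D-prim, D-top, B.

Skeleton (crux-plan, planner-cruxplan-stmt-SmoothPoincare4-10507-folded-curve-branch--0,
2026-08-16, round 2) of the crux idea `Cruxes/AcyclicBisectionRigidity/Ideas/folded-curve-branch-locus.md`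
(ideator 4; triage TRIAGE-r2-1 pass, r2-2 pass, r2-3 fail-on-K2; merged by all three triagers with
`branch-two-knot-quotient`, whose skeleton `Lines/branch_two_knot_quotient.lean` DIED at
`stub_braidDescent` — lead c8, `Lines/branch-two-knot-quotient-dead.md`).  This skeleton is built so
that the step that died is NOT a stub of it (see "Dead lines avoided" below) and so that three of its
four stubs are theorems in print.

THE CRUX.  For every Hausdorff second-countable `C^∞` 4-manifold `M ≃ₕ S⁴`: if `M = e₁(W₁) ∪ e₂(W₂)`
for two smoothly embedded compact Stein domains meeting exactly along the images of their boundaries,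
with the complex tangencies pushed forward to ONE plane field on the seam and both halves ℚ-acyclic in
positive degrees, then `M ≅ S⁴`.

THE LEVER (card, re-read through the triage).  The two Stein halves are the two sheets of a FOLD: a
"folded holomorphic curve / folded Kähler structure" `S⁴ ⊇ B⁴ ∪ B̄⁴`, i.e. (Loi–Piergallini 2001 ⇔
Akbulut–Ozbagci 2001) a PAIR OF POSITIVE ALLOWABLE LEFSCHETZ FIBRATIONS over the two hemispheres
`D₊`, `D₋` of a 2-sphere, and the crux is to be decided on the fold data, never by comparing `W₁` with
`W₂`.  The card descended one step further, to the branch locus of a hyperelliptic presentation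
`M = Σ₂(S⁴, S₁ ∪ S̄₂)`; the triage kept the fold and killed the symmetrisation lever K2
(r2-3: `τ₃(3₁)`), and the twin line then died trying to make the descent COMMON to both halves
(a positivity-compatible absorption of `ker(L_q → Mod(P,∂))`, "in no paper").  Here:

* the COMMON structure is taken UPSTAIRS, where it is a theorem: the two Stein fillings of the
  contactomorphic seams become PALFs over ONE open book after common positive stabilisation
  (Giroux 2002, the hard direction of the 3-dimensional Giroux correspondence — stabilisation
  equivalence proved in print by Breen–Honda–Huang arXiv:2307.02317 Thm. 1.1.8; stabilisations
  realised by PALF stabilisations, Akbulut–Ozbagci / Etnyre), so that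
  `M = X(F; P) ∪_{book} X̄(F; N̄)`, which in the tree's vocabulary is EXACTLY a sorted FIBRED achiral
  Lefschetz model `LefschetzBase.ModelsOnFibred M g (P ++ N)` (Baykur 2006 §5 / Etnyre–Fuller 2006,
  file `Literature/Topology/FourManifolds/LefschetzHandlebody.lean`), with the halves' ℚ-acyclicity
  read off the words (Kas 1980: `H₁(X(F;P);ℚ) = ℚ^{2g}/⟨shadows⟩`, `χ = 1 − 2g + |P|`):
  `|P| = |N| = 2g` and both shadow sets span `ℚ^{2g}` — **Stub A, KNOWN** (Wendl-free, all genera;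
  it is the matched normal form that crux 6 `ResidualAcyclicBisectionRigidity` records as missing
  off the planar sector);
* the branch locus returns as the ENGINE of the two low rungs: genus `0` is the twisted-sphere /
  seam-`S³` sector (**Stub C, KNOWN**: Cerf); genus `1` is the DEGREE-3 BRANCH LOCUS — `Mod(F_{1,1},∂) = B₃`
  (Birman–Hilden), the two hemispheres are quasipositive factorisations of ONE 3-braid of exponent
  sum `2`, which have AT MOST TWO Hurwitz orbits (Orevkov arXiv:1409.4726 Thm. 3, read), same-orbit
  pairs glue to Mazur doubles `D(S¹×B³ ∪ h²) = S⁴`, cross-orbit pairs are the `S³/Q₈`-type torsion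
  gluings of Disproof §5b — **Stub D, concrete `B₃` engine** (the card's "rigidity is real at low
  complexity" rung, corrected: Kamada 1992 gives braid index `3 ⇒ ribbon`, NOT unknotted —
  Encyclopedia of Knot Theory ch. 45, read; and qp factorisations of 3-braids are NOT unique —
  Orevkov's example `σ₁²σ₂²σ₁²σ₂²Δ⁻²`);
* the open core is confined to fold genus `≥ 2` (**Stub B**), where the card's own territory begins:
  Hayden's non-twin inhabitant and the positron pair are genus-2 hyperelliptic folds, i.e.
  `M = Σ₂(S⁴, R)` for a group-`ℤ` 2-knot `R` (card K2′ / P1; TOP-standard by Freedman–Conway–Powell),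
  Hurwitz-equivalent hemispheres give doubles (item stmt-SmoothPoincare4-3546 / 3717), and the word
  calculus of the sibling cards (stable signed-Hurwitz nullity) acts on exactly these words.

THE LINE (four registered stubs; composition `AcyclicBisectionRigidity_of`, kernel-checked, no `sorry`
of its own, case split on the fold genus `g = 0 | 1 | ≥ 2`):
* `stub_foldedNormalForm`  (A) — acyclic common-contact Stein bisection ⇒ sorted balanced spanning
  fibred Lefschetz model.  KNOWN (AO2001 + LP2001 + Plamenevskaya 2004 + Giroux 2002 /
  Breen–Honda–Huang 2023 + Baykur 2006 / Etnyre–Fuller 2006 + Kas 1980).  NOT SPC4-shielded (no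
  `M ≃ₕ S⁴`; a structure statement).  Size XL.
* `stub_unfoldedSphere`    (C) — a genus-`0` fibred model with empty word is `S⁴` (`Base 0 ≅ D⁴`,
  twisted sphere, Cerf `Γ₄ = 0` = tree fact `cerf_twistedSphere_four`).  KNOWN.  Size M–L.
* `stub_genusOneFold`      (D) — homotopy 4-spheres with a genus-`1` sorted balanced spanning fold are
  `S⁴`.  Engine: `B₃` (Orevkov's finite orbit structure; Mazur doubles — tree `MazurDouble*.lean`;
  the cross-orbit census).  SPC4-implied as stated; plausibly a theorem.  Size L–XL.
* `stub_higherGenusFold`   (B) — the same for fold genus `≥ 2`.  THE OPEN CORE (SPC4-implied; with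
  Stub A and Baykur's tree fact `steinRealisation_of_sorted_modelsOnFibred` it is the crux restricted
  to fold genus `≥ 2`, read on the fold).  Size: open-problem.

DISPROOF.LEAN HONOURED (`Cruxes/AcyclicBisectionRigidity/Disproof.lean`, gen 5 v18, read 2026-08-16;
landed `Theorems/AcyclicBisectionRigidity/Negative/*`):
`false_without_homotopyEquiv` (§3) — `H : M ≃ₕ S⁴` is consumed by Stubs B and D (the only stubs
concluding `≅ S⁴` from fold data of positive genus; without `H`, `D(B_{p,q})`-type doubles and
`D(X_L)` (`π₁ = ℤ/2`, genus-1 words with index-2 shadow lattice) are folded and not spheres) and for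
compactness / non-emptiness / connectedness in the composition; Stub A deliberately does NOT take `H`
(refutable without an exotic sphere) but DOES take ℚ-acyclicity, the conjunct separating the crux from
SPC4 (`collapse_without_acyclic`): it is exactly what makes the words balanced and spanning, and
WITHOUT those two clauses Stub B would be SPC4 verbatim (every closed oriented 4-manifold has a sorted
fibred model: Etnyre–Fuller + Hurwitz sorting).  The contact-matching conjunct is USED (Stub A, through
Giroux–Goodman) — the line does not prove the stronger contact-free statement.  §2 junk: `M = ∅`
satisfies the bisection hypothesis (two empty halves) and has no fibred model — excluded by
`[Nonempty M]` in Stub A, supplied from `H`; `S⁴ ⊔ S⁴` likewise by `[ConnectedSpace M]`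
(`pathConnectedSpace_of_homotopyEquiv`).  §4b/§12/§12b (`crux ⇒ PresentationSpheresStandard`,
`crux_iff_three_sectors`): the DoubleSector sits inside Stubs D (genus 1: Mazur, standard) and B
(genus ≥ 2: item 3717's territory, named as such, not dressed as a lever).  §5b/§5d/§13d (torsion
seams `S³/Q₈`, `Y(p)`, T6): genus-1 folds with an index-2 shadow lattice are precisely the ℤ/2-torsion
halves; Orevkov's second Hurwitz orbit is where the non-double `S³/Q₈` bisection of `S⁴` must sit if
its fold genus is 1 (Stub D's first test object); the 324 T6 spheres are planar `k = 5`, fold genus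
`4` after binding-connecting stabilisations (Stub B).  §6/§9e (twins refuted, Hayden): NO stub
concludes a diffeomorphism of the halves or Hurwitz equivalence of `P` with `N̄`; inequivalent pairs are
the generic input.  §13a (`DoubleReduction` is a costume): no stub reduces to doubles.  §13c (type
count kills MONOTONE word reduction at `k = 5`): no stub asserts monotone reducibility; the fold words
here are stabilised (binding connected), where §13c (b) records the obstruction void.  Negatives index
(`ledger negatives --problem SmoothPoincare4`, 2026-08-16): 0 refuted statements; no landed Negative
lemma has an instance among the stubs.

DEAD LINES AVOIDED.  `branch-two-knot-quotient` died at `stub_braidDescent` = common POSITIVE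
BRAIDED-SURFACE presentation of both fillings over one closed braid (needs `β_P = β_N` in `B_m`, i.e.
absorbing `ker(L_q → Mod(P,∂))`; unpublished).  Here the common object is the common OPEN BOOK
(Giroux–Goodman), which needs no descent: `β_P`, `β_N` may stay different liftable braids with equal
lifts.  The Piergallini–Zuddas band (arXiv:1602.07459 Lemma 3.4 / Thm. 1.8, read: any two `d ≥ 5`
simple covers `Γ → S³` bounding ribbon covers extend over `Γ × I`) would give the card's "neutral
cobordism `T`", but presenting `M` ITSELF through it needs the band to realise the GIVEN seam
identification — functoriality of the Bobtcheva–Piergallini covering calculus, not in print — so no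
stub of this line descends to `S⁴` in general; the descent is used only in genus 1, where Birman–Hilden
makes the kernel trivial.  `minimal-factorisation-rigidity` / `szego-relative-index-path` died on
"twins": no twins statement here.  `seam-duality-cancellation` / `exchange-recognition` died on a
crux-equivalent apex (`stub_gscOfNonDouble`): the apex here (Stub B) is the crux RESTRICTED to fold
genus `≥ 2` and stated on combinatorial data, with genus `≤ 1` split off as theorems.
-/

noncomputable section

open scoped Manifold ContDiff Topology ContinuousMap
open Set Function
open CategoryTheory.Limits
open Literature.Geometry.Symplectic Literature.AlgebraicTopology.SingularHomology
open Literature.Topology.FourManifolds Literature.Topology.FourManifolds.LefschetzBase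
open Literature.GroupTheory.CombinatorialGroupTheory.SignedHurwitz

-- The namespace is prescribed by the crux protocol (`Summit.<P>.<Sub>.Cruxes.<Crux>.<Slug>` with
-- `P = Sub = SmoothPoincare4`), hence the duplicated component.
set_option linter.dupNamespace false
set_option linter.unusedVariables false

namespace Summit.SmoothPoincare4.SmoothPoincare4.Cruxes.AcyclicBisectionRigidity.FoldedCurveBranchLocus

open Summit.SmoothPoincare4.SmoothPoincare4.Theses

/-- Local notation: `𝔼 n = ℝⁿ` (model space). -/
local notation "𝔼 " n:arg => EuclideanSpace ℝ (Fin n)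

/-- Local notation: the round 4-sphere `S⁴ ⊂ ℝ⁵`, the carrier of the summit statement. -/
local notation "𝕊⁴" => (Metric.sphere (0 : EuclideanSpace ℝ (Fin 5)) 1)

/-! ## The fold vocabulary (documentation-level abbreviations; the stubs below are stated with these
conditions written out, over `Literature`/Mathlib names only, so that `--supports` files can restate
them verbatim) -/

/-- The ℚ-span of the homology shadows of a signed word `l` over the genus-`g` page `F_{g,1}`
(`H₁(F_{g,1}; ℤ) = ℤ^{2g}` in the `A_{2g}` coordinates of `LefschetzBase.shadow`) is everything:
by Kas' handle description `H₁(X(F_{g,1}; l); ℚ) = ℚ^{2g} / span(shadows)`, so this says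
`b₁(X(F; l)) = 0`. -/
def ShadowsSpan (g : ℕ) (l : List ((Fin g ⊕ Fin g → ℤ) × Bool)) : Prop :=
  Submodule.span ℚ (Set.range fun i : Fin l.length => fun j : Fin g ⊕ Fin g => ((l.get i).1 j : ℚ)) = ⊤

/-- **Folded word of genus `g`**: a SORTED pair — `P` positive letters (the northern hemisphere's
PALF), `N` negative letters (the southern one, upside down) — which is ALLOWABLE (no null-homologous
vanishing cycle), BALANCED (`|P| = |N| = 2g`, i.e. `χ = 1` for both halves) and SPANNING (both shadow
sets span `ℚ^{2g}`, i.e. `b₁ = 0` for both halves): exactly the fold data of an ACYCLIC common-contact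
Stein bisection (Stub A) — and without "balanced + spanning" every closed oriented 4-manifold would
qualify (Etnyre–Fuller + Hurwitz sorting), which is how ℚ-acyclicity keeps Stub B below SPC4. -/
def IsFoldedWord (g : ℕ) (P N : List ((Fin g ⊕ Fin g → ℤ) × Bool)) : Prop :=
  (∀ x ∈ P, x.2 = true) ∧ (∀ x ∈ N, x.2 = false) ∧ (∀ x ∈ P ++ N, x.1 ≠ 0) ∧
    P.length = 2 * g ∧ N.length = 2 * g ∧ ShadowsSpan g P ∧ ShadowsSpan g N

/-- The `∃`-body of the crux for one manifold `M` (verbatim from the route file): an acyclic Stein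
bisection of `M` along a common contact seam. -/
def AcyclicBisection (M : Type) [TopologicalSpace M] [ChartedSpace (𝔼 4) M] : Prop :=
  ∃ (W₁ : Type) (_ : TopologicalSpace W₁) (_ : ChartedSpace (EuclideanHalfSpace 4) W₁)
    (_ : IsManifold (𝓡∂ 4) ∞ W₁) (_ : CompactSpace W₁) (W₂ : Type) (_ : TopologicalSpace W₂)
    (_ : ChartedSpace (EuclideanHalfSpace 4) W₂) (_ : IsManifold (𝓡∂ 4) ∞ W₂) (_ : CompactSpace W₂)
    (J₁ : Literature.Geometry.Symplectic.SteinStructure W₁)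
    (J₂ : Literature.Geometry.Symplectic.SteinStructure W₂) (e₁ : W₁ → M) (e₂ : W₂ → M),
    Manifold.IsSmoothEmbedding (𝓡∂ 4) (𝓡 4) ∞ e₁ ∧ Manifold.IsSmoothEmbedding (𝓡∂ 4) (𝓡 4) ∞ e₂ ∧
    Set.range e₁ ∪ Set.range e₂ = Set.univ ∧
    Set.range e₁ ∩ Set.range e₂ = e₁ '' (𝓡∂ 4).boundary W₁ ∧
    Set.range e₁ ∩ Set.range e₂ = e₂ '' (𝓡∂ 4).boundary W₂ ∧
    (∀ w₁ w₂, e₁ w₁ = e₂ w₂ →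
      Submodule.map (mfderiv (𝓡∂ 4) (𝓡 4) e₁ w₁).toLinearMap
          (Literature.Geometry.Symplectic.contactPlane J₁.J w₁) =
        Submodule.map (mfderiv (𝓡∂ 4) (𝓡 4) e₂ w₂).toLinearMap
          (Literature.Geometry.Symplectic.contactPlane J₂.J w₂)) ∧
    (∀ k, 0 < k →
      CategoryTheory.Limits.IsZero
          (Literature.AlgebraicTopology.SingularHomology.singularHomology ℚ ℚ W₁ k) ∧
        CategoryTheory.Limits.IsZero
          (Literature.AlgebraicTopology.SingularHomology.singularHomology ℚ ℚ W₂ k))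

/-- The crux is literally `∀ M ≃ₕ S⁴, AcyclicBisection M → M ≅ S⁴` (definitional check that the body
above is verbatim). -/
theorem crux_iff :
    ConvexBisection.AcyclicBisectionRigidity ↔
      ∀ (M : Type) [TopologicalSpace M] [T2Space M] [SecondCountableTopology M]
        [ChartedSpace (𝔼 4) M] [IsManifold (𝓡 4) ∞ M],
        M ≃ₕ 𝕊⁴ → AcyclicBisection M → Nonempty (M ≃ₘ⟮𝓡 4, 𝓡 4⟯ 𝕊⁴) :=
  Iff.rfl

/-- **Fold recognition in genus `g`** (the common shape of Stubs B, C, D): every homotopy 4-sphere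
with a genus-`g` folded fibred Lefschetz model is standard. -/
def FoldRecognition (g : ℕ) : Prop :=
  ∀ (M : Type) [TopologicalSpace M] [T2Space M] [SecondCountableTopology M]
    [ChartedSpace (𝔼 4) M] [IsManifold (𝓡 4) ∞ M],
    M ≃ₕ 𝕊⁴ → ∀ (P N : List ((Fin g ⊕ Fin g → ℤ) × Bool)), IsFoldedWord g P N →
      ModelsOnFibred M g (P ++ N) → Nonempty (M ≃ₘ⟮𝓡 4, 𝓡 4⟯ 𝕊⁴)

/-- A point of the round 4-sphere (to pull non-emptiness of `M` back along `M ≃ₕ S⁴`). -/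
def basePoint : 𝕊⁴ :=
  ⟨EuclideanSpace.single 0 1, by simp⟩

/-- The round 4-sphere is path connected (`isPathConnected_sphere` in dimension `5 > 1`). [folklore] -/
theorem pathConnectedSpace_sphereFour : PathConnectedSpace 𝕊⁴ := by
  refine isPathConnected_iff_pathConnectedSpace.mp (isPathConnected_sphere ?_ 0 zero_le_one)
  rw [← Module.finrank_eq_rank, finrank_euclideanSpace_fin]
  exact Nat.one_lt_cast.mpr (by norm_num)

/-! ## Facts of the Lefschetz dictionary (fact stub) and the folded normal form of a homotopy
4-sphere (PROVED from them; replaces the planner's Stub A — see the module docstring, reshape s3) -/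

/-- **Fact stub — the four named facts of the Lefschetz-handlebody dictionary** (all `def … : Prop` of
`Literature/Topology/FourManifolds/LefschetzModelFacts.lean`, none with `_holds` yet; shared verbatim with
crux stmt-SmoothPoincare4-10508 `AcyclicBisectionExists`, line `modp-braid-orbits`): NF1
`modelsOnFibred_exists` (Etnyre–Fuller 2006 Thm. 1 / Prop. 12, Baykur 2006 Lemma 1), NF2
`modelsOn_counts_of_homotopyEquiv_sphere` (Gompf–Stipsicz 1999 §8.2), NF3
`modelsOnFibred_balance_of_homotopyEquiv_sphere` (Etnyre–Fuller 2006 eq. (d3)), NF4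
`modelsOnFibred_of_reach` (Baykur 2006 §5 / Lemma 1).  Registered so that the composition keeps the shape
of the crux and the debts stay visible; it closes when the four `_holds` land (debt queue of 10508).
[cite: EtnyreFuller2006, Thm. 1, Prop. 12, eq. (d3)] [cite: Baykur2006, Lemma 1 and §5]
[cite: GompfStipsicz1999, §8.2] -/
theorem stub_factLefschetz :
    modelsOnFibred_exists ∧ modelsOn_counts_of_homotopyEquiv_sphere ∧
      modelsOnFibred_balance_of_homotopyEquiv_sphere ∧ modelsOnFibred_of_reach := by
  sorry

section Bookkeeping

open Summit.SmoothPoincare4.SmoothPoincare4.Theorems.AcyclicBisectionExists.ModpBraidOrbits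

variable {g : ℕ}

/-- `ratWord` is the change of coefficients along `ℤ → ℚ`. [folklore] -/
theorem ratWord_eq_mapWord' (l : IntWord g) :
    ratWord l = mapWord (fun (v : Fin g ⊕ Fin g → ℤ) i => Int.castRingHom ℚ (v i)) l := rfl

/-- Trivial integral signed monodromy stays trivial over `ℚ` (adapted from line `modp-braid-orbits`,
`wordProduct_ratWord_eq_one`). [folklore] -/
theorem wordProduct_ratWord_eq_one' {l : IntWord g} (h : wordProduct (stdSymp ℤ g) l = 1) :
    wordProduct (stdSymp ℚ g) (ratWord l) = 1 := by
  refine (Pi.basisFun ℚ (Fin g ⊕ Fin g)).ext fun i => ?_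
  have key := map_wordProduct (Int.castRingHom ℚ) g l (Pi.single i 1)
  rw [h] at key
  have hb : (Pi.basisFun ℚ (Fin g ⊕ Fin g)) i =
      fun j => Int.castRingHom ℚ ((Pi.single i (1 : ℤ) : _ → ℤ) j) := by
    ext j; simp [Pi.basisFun_apply, Pi.single_apply]
  rw [hb, ratWord_eq_mapWord', ← key]
  rfl

/-- The classes of a word are the first components of its letters. [folklore] -/
theorem letters_eq_range {V : Type*} (l : List (V × Bool)) :
    letters l = Set.range (fun i : Fin l.length => (l.get i).1) := by
  ext v
  simp only [letters, Set.mem_setOf_eq, Set.mem_range]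
  constructor
  · rintro ⟨s, hs⟩
    obtain ⟨i, hi⟩ := List.get_of_mem hs
    exact ⟨i, by rw [hi]⟩
  · rintro ⟨i, rfl⟩
    exact ⟨(l.get i).2, List.get_mem l i⟩

/-- The rational shadows of a word, as a range over its positions, are the classes of its
rationalisation. [folklore] -/
theorem range_ratShadow_eq (P : List ((Fin g ⊕ Fin g → ℤ) × Bool)) :
    (Set.range fun i : Fin P.length => fun j : Fin g ⊕ Fin g => ((P.get i).1 j : ℚ)) =
      letters (ratWord P) := by
  rw [ratWord, letters_mapWord, letters_eq_range, ← Set.range_comp]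
  rfl

/-- In a word all of whose letters are negative, the negative classes are all the classes. [folklore] -/
theorem classesOfSign_false_eq_letters_of_forall {V : Type*} {N : List (V × Bool)}
    (hN : ∀ x ∈ N, x.2 = false) : classesOfSign N false = letters N := by
  ext v
  simp only [classesOfSign, letters, Set.mem_setOf_eq]
  constructor
  · intro h; exact ⟨false, h⟩
  · rintro ⟨s, hs⟩
    have := hN _ hs
    simp only at this
    subst this
    exact hs

/-- In a word all of whose letters are positive there are no negative classes. [folklore] -/
theorem classesOfSign_false_eq_empty_of_forall {V : Type*} {P : List (V × Bool)}
    (hP : ∀ x ∈ P, x.2 = true) : classesOfSign P false = ∅ := by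
  ext v
  simp only [classesOfSign, Set.mem_setOf_eq, Set.mem_empty_iff_false, iff_false]
  intro h
  have := hP _ h
  simp at this

/-- The negative classes of a sorted word `P ++ N` are the classes of `N`. [folklore] -/
theorem classesOfSign_false_sorted {V : Type*} {P N : List (V × Bool)} (hP : ∀ x ∈ P, x.2 = true)
    (hN : ∀ x ∈ N, x.2 = false) : classesOfSign (P ++ N) false = letters N := by
  rw [classesOfSign_append, classesOfSign_false_eq_empty_of_forall hP,
    classesOfSign_false_eq_letters_of_forall hN, Set.empty_union]

end Bookkeeping

open Summit.SmoothPoincare4.SmoothPoincare4.Theorems.AcyclicBisectionExists.ModpBraidOrbits in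
/-- **The folded normal form of a homotopy 4-sphere, from the four facts** (replaces Stub A; found by
worker A of this lead, kernel-checked here for `M ≃ₕ S⁴` with the TREE's facts NF1–NF4, exactly as
`stub_sortedModelOfHandleSplitting_of` of crux 10508 does): every Hausdorff second-countable `C^∞`
4-manifold `M ≃ₕ S⁴` has a SORTED, ALLOWABLE, BALANCED (`|P| = |N| = 2g`), BI-SPANNING fibred Lefschetz
model `ModelsOnFibred M g (P ++ N)`.  Chain: compact / connected / orientable (proved homotopy-sphere facts)
→ NF1 an allowable fibred model `(g, l)` → NF2 `|l| = 4g`, classes span, `wordProduct l = 1`; NF3 `2g`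
positive → `stub_exchange` (positive classes spanning inside `Reach`) → `stub_reachInvariants` (monodromy
stays trivial) → `stub_sortBiSpan` over `ℚ` → `hurwitzOrbit_lift` → NF4 (still a fibred model).  NOTE: the
Stein bisection of the crux plays NO role — this is why Stub B is SPC4-equivalent (certificates at the end).
[cite: EtnyreFuller2006, Thm. 1, Prop. 12, eq. (d3)] [cite: Baykur2006, Lemma 1 and §5] -/
theorem foldedNormalForm_of_facts
    (h₁ : modelsOnFibred_exists) (h₂ : modelsOn_counts_of_homotopyEquiv_sphere)
    (h₃ : modelsOnFibred_balance_of_homotopyEquiv_sphere) (h₄ : modelsOnFibred_of_reach)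
    (M : Type) [TopologicalSpace M] [T2Space M] [SecondCountableTopology M]
    [ChartedSpace (𝔼 4) M] [IsManifold (𝓡 4) ∞ M] (e : M ≃ₕ 𝕊⁴) :
    ∃ (g : ℕ) (P N : List ((Fin g ⊕ Fin g → ℤ) × Bool)),
      (∀ x ∈ P, x.2 = true) ∧ (∀ x ∈ N, x.2 = false) ∧ (∀ x ∈ P ++ N, x.1 ≠ 0) ∧
      P.length = 2 * g ∧ N.length = 2 * g ∧
      Submodule.span ℚ (Set.range fun i : Fin P.length =>
        fun j : Fin g ⊕ Fin g => ((P.get i).1 j : ℚ)) = ⊤ ∧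
      Submodule.span ℚ (Set.range fun i : Fin N.length =>
        fun j : Fin g ⊕ Fin g => ((N.get i).1 j : ℚ)) = ⊤ ∧
      ModelsOnFibred M g (P ++ N) := by
  -- `M` is compact, connected, orientable (proved homotopy-sphere facts of the tree)
  haveI : CompactSpace M := compactSpace_of_homotopyEquiv_sphere_four_holds M e
  haveI : PathConnectedSpace 𝕊⁴ := pathConnectedSpace_sphereFour
  haveI : PathConnectedSpace M := pathConnectedSpace_of_homotopyEquiv e
  have hor : IsOrientable (𝓡 4) M := isOrientable_of_homotopyEquiv_sphere_four_holds M e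
  -- NF1: an allowable fibred model
  obtain ⟨g, l, hnz, hfib⟩ := h₁ M hor
  -- NF2, NF3: counts and balance of a homotopy sphere
  obtain ⟨hlen, hspan, hprod⟩ := h₂ M g l e hfib.modelsOn
  have hbal : (l.filter (·.2)).length = 2 * g := h₃ M g l e hfib
  -- the exchange engine: positive classes spanning, inside the `Reach`-class
  obtain ⟨g', l', hreach, hlen', hbal', hpos'⟩ := stub_exchange g l hlen hbal hnz hspan
  -- trivial monodromy persists and descends to `ℚ`
  have hprodQ : wordProduct (stdSymp ℚ g') (ratWord l') = 1 :=
    wordProduct_ratWord_eq_one' (stub_reachInvariants g l g' l' hreach hprod)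
  -- bi-span sorting over `ℚ` inside the Hurwitz orbit
  obtain ⟨m', hm', hsorted', hposQ, hnegQ⟩ := stub_sortBiSpan ℚ g' (ratWord l') (ratWord l')
    (by rw [ratWord, length_mapWord, hlen']) (by rw [ratWord, length_filter_mapWord, hbal']) hprodQ
    (HurwitzOrbit.refl _ _) hpos'
  -- lift to the integral orbit
  obtain ⟨l'', hl'', hrat⟩ := hurwitzOrbit_lift (Int.castRingHom ℚ) g' l' (m := m')
    (by rwa [← ratWord_eq_mapWord'])
  rw [← ratWord_eq_mapWord'] at hrat
  subst hrat
  have hsorted : Sorted l'' := Sorted.of_mapWord _ hsorted'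
  have hreach'' : Reach g l g' l'' := hreach.trans_hurwitzOrbit hl''
  -- NF4: still a fibred model; bookkeeping along `Reach`
  have hfib'' : ModelsOnFibred M g' l'' := h₄ M g l g' l'' hfib hreach''
  have hnz'' : ∀ x ∈ l'', x.1 ≠ 0 := hreach''.forall_ne_zero hnz
  have hlen'' : l''.length = 4 * g' := hreach''.length_eq_four_mul hlen
  have hbal'' : (l''.filter (·.2)).length = 2 * g' := hreach''.length_filter_eq_two_mul hbal
  obtain ⟨P, N, rfl, hP, hN⟩ := hsorted
  have hlenP : P.length = 2 * g' := by rw [← hbal'', filter_snd_sorted hP hN]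
  have hlenN : N.length = 2 * g' := by
    rw [List.length_append] at hlen''
    omega
  have hposQ' : Submodule.span ℚ (letters (ratWord P)) = ⊤ := by
    have e : classesOfSign (ratWord (P ++ N)) true = letters (ratWord P) := by
      rw [ratWord, mapWord_append]
      exact classesOfSign_true_sorted (forall_snd_mapWord _ hP) (forall_snd_mapWord _ hN)
    rw [← e]; exact hposQ
  have hnegQ' : Submodule.span ℚ (letters (ratWord N)) = ⊤ := by
    have e : classesOfSign (ratWord (P ++ N)) false = letters (ratWord N) := by
      rw [ratWord, mapWord_append]
      exact classesOfSign_false_sorted (forall_snd_mapWord _ hP) (forall_snd_mapWord _ hN)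
    rw [← e]; exact hnegQ
  refine ⟨g', P, N, hP, hN, hnz'', hlenP, hlenN, ?_, ?_, hfib''⟩
  · rw [range_ratShadow_eq]; exact hposQ'
  · rw [range_ratShadow_eq]; exact hnegQ'

/-! ## Genus zero: the unfolded sphere (LANDED, worker C of lead a4: p132915, p134180, p134910) -/

/-- **Stub C — THE UNFOLDED SPHERE (genus `0`), CLOSED**: a Hausdorff second-countable `C^∞`
4-manifold with a genus-`0` fibred Lefschetz model of empty word is `S⁴`, granted Cerf's `Γ₄ = 0`.
One-line alias of the landed theorem
`Summit.SmoothPoincare4.SmoothPoincare4.Theorems.AcyclicBisectionRigidity.FoldedCurveBranchLocus.stub_unfoldedSphere`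
(`Theorems/ConvexBisectionAcyclicBisectionRigidityStubUnfoldedSphere.lean`: `Base 0 ≅ 𝔻⁴` by the Morse
perturbation `rho 0 + ε·baseCut(rho 0)·σ` with unique critical point `(−1, 0)` of index `0` and the tree's
Milnor disc theorem; `X ≅ Base 0` by `IsMultiAttachment.nonempty_diffeomorph_of_isEmpty`; gluing transport;
`M` is a twisted sphere `isTwistedSphere_of_modelsOnFibred_zero`; Cerf).  Registered signature unchanged
(reshape s2). [cite: Cerf1968, main theorem (Γ₄ = 0)] -/
theorem stub_unfoldedSphere :
    Literature.Topology.FourManifolds.cerf_twistedSphere_four →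
    ∀ (M : Type) [TopologicalSpace M] [T2Space M] [SecondCountableTopology M]
      [ChartedSpace (𝔼 4) M] [IsManifold (𝓡 4) ∞ M],
      ModelsOnFibred M 0 ([] : List ((Fin 0 ⊕ Fin 0 → ℤ) × Bool)) →
      Nonempty (M ≃ₘ⟮𝓡 4, 𝓡 4⟯ 𝕊⁴) :=
  Summit.SmoothPoincare4.SmoothPoincare4.Theorems.AcyclicBisectionRigidity.FoldedCurveBranchLocus.stub_unfoldedSphere

/-- **Fact stub — Cerf's `Γ₄ = 0` in twisted-sphere form** (tree NAMED FACT
`Literature.Topology.FourManifolds.cerf_twistedSphere_four`, Cerf 1968; no `_holds` in the tree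
yet).  Registered as a stub of the line so that the composition stays unconditional in shape and
the debt is visible: it closes the day `cerf_twistedSphere_four_holds` lands (debt queue); consumed by
the genus-`0` rung `stub_unfoldedSphere` and the genus-`1` rung `stub_genusOneTopRecognition` (twisted
4-spheres are standard by Cerf and by nothing cheaper, `Literature/Barriers/SmoothPoincare4/TwistedSphereBarrierFour`).
[cite: Cerf1968, main theorem (Γ₄ = 0)] -/
theorem stub_factCerf : Literature.Topology.FourManifolds.cerf_twistedSphere_four := by
  sorry

/-! ## Genus one: Matsumoto's normal form (reshape s3 after worker D's census) -/

/-- **Stub D-prim — PAGE CURVES WITH NON-ZERO SHADOW ARE PRIMITIVE (genus 1; dictionary, size S–M on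
paper, M–L in Lean).**  In a genus-`1` fibred model every letter with non-zero shadow is a PRIMITIVE vector
of `H₁(F_{1,1}; ℤ) = ℤ²`: the attaching circle is an EMBEDDED circle in a page `≅ F_{1,1}`
(`IsLefschetzLink.mem_page`), an embedded circle with non-zero class is non-separating, and a non-separating
simple closed curve on the once-holed torus is primitive (it has a dual curve meeting it once; Rolfsen
§2.C, Farb–Margalit Prop. 1.5 / §1.2.2).  Needed because Matsumoto's theorem is about transvections
conjugate to `X^{±1}`, i.e. PRIMITIVE letters (`T_{mv} = T_v^{m²}`).  Not SPC4-shielded; true on paper.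
STATUS (wave 2 audit, `stub_genusOnePrimitive_AUDIT.md`): blocked on ONE surface-topology fact absent from the
tree — `PageCurvePrimitive : ∀ c, ‖c‖ = 1 → ∀ K : 𝕊¹ → Base 1 continuous injective with image in page 1 c,
shadow 1 K ≠ 0 → IsPrimitive (shadow 1 K)`; the implication `PageCurvePrimitive → stub` is kernel-checked in the
lead's folder (`work/stubs/stub_genusOnePrimitive.lean`); the concrete page IS the open once-holed torus
(`homologyOne_page`, `bijective_map_pageIncl_one` of 10508). [cite: FarbMargalit2012, Prop. 1.5 and §1.2.2] -/
theorem stub_genusOnePrimitive :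
    ∀ (M : Type) [TopologicalSpace M] [T2Space M] [SecondCountableTopology M]
      [ChartedSpace (𝔼 4) M] [IsManifold (𝓡 4) ∞ M] (l : IntWord 1),
      ModelsOnFibred M 1 l → ∀ x ∈ l, x.1 ≠ 0 → IsPrimitive x.1 := by
  sorry

/-- **D-alg — MATSUMOTO'S NORMAL FORM FOR FOUR LETTERS, classes up to sign (THEOREM, landed p139869).**
Matsumoto, J. Math. Soc. Japan 37 (1985), Thm. 3.2 for `ν = 4`, in the tree's words: a word of four PRIMITIVE
signed letters over `stdSymp ℤ 1`, two of each sign, with `wordProduct = 1` is in the signed Hurwitz orbit of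
`[(u,η),(±u,¬η),(w,η′),(±w,¬η′)]`.  One-line alias of the landed
`…Theorems.AcyclicBisectionRigidity.FoldedCurveBranchLocus.helper_matsumotoNormalForm_pm`.  The exactly-signed
form registered in s3 (`stub_matsumotoNormalForm`) is FALSE and refuted in the tree
(`helper_matsumotoNormalForm_exact_false`, p139060); it is no longer a stub of this line.
[cite: Matsumoto1985, Thm. 3.2] -/
theorem matsumotoNormalForm_pm :
    ∀ (l : IntWord 1), l.length = 4 → (l.filter (·.2)).length = 2 → (∀ x ∈ l, IsPrimitive x.1) →
      wordProduct (stdSymp ℤ 1) l = 1 →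
      ∃ (u u' w w' : Fin 1 ⊕ Fin 1 → ℤ) (η η' : Bool), (u' = u ∨ u' = -u) ∧ (w' = w ∨ w' = -w) ∧
        HurwitzOrbit (stdSymp ℤ 1) l [(u, η), (u', !η), (w, η'), (w', !η')] :=
  Summit.SmoothPoincare4.SmoothPoincare4.Theorems.AcyclicBisectionRigidity.FoldedCurveBranchLocus.helper_matsumotoNormalForm_pm

/-- **D-det — A HOMOTOPY SPHERE IN NORMAL FORM HAS `|u × w| = 1` (THEOREM, landed p136292 as registered).**
One-line alias of `…Theorems.AcyclicBisectionRigidity.FoldedCurveBranchLocus.stub_genusOneDet` (integral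
excision for the gluing `M = X ∪ Base 1`, `H²(Base 1; ℤ) = 0` over the concrete base, NF5
`isLefschetzHandlebody_homology_holds`, `ℤu + ℤw = ℤ² ⇒ u × w = ±1`). [cite: GompfStipsicz1999, §8.2] -/
theorem stub_genusOneDet :
    ∀ (M : Type) [TopologicalSpace M] [T2Space M] [SecondCountableTopology M]
      [ChartedSpace (𝔼 4) M] [IsManifold (𝓡 4) ∞ M],
      M ≃ₕ 𝕊⁴ → ∀ (u w : Fin 1 ⊕ Fin 1 → ℤ) (η η' : Bool),
      ModelsOnFibred M 1 [(u, η), (u, !η), (w, η'), (w, !η')] →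
      (stdSymp ℤ 1 u w = 1 ∨ stdSymp ℤ 1 u w = -1) :=
  Summit.SmoothPoincare4.SmoothPoincare4.Theorems.AcyclicBisectionRigidity.FoldedCurveBranchLocus.stub_genusOneDet

/-- **D-det for the ±-normal form** (proved here from the landed helpers of p136292: the letters of ANY
one-sided model of a homotopy 4-sphere span `ℤ^{2g}` integrally, `span_letters_eq_top_of_gluing_base`; the
letters of `[(u,η),(u′,¬η),(w,η′),(w′,¬η′)]` with `u′ = ±u`, `w′ = ±w` lie in `ℤu + ℤw`; a generating pair of
`ℤ²` has determinant `±1`). [cite: GompfStipsicz1999, §8.2] -/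
theorem genusOneDet_pm (M : Type) [TopologicalSpace M] [T2Space M] [SecondCountableTopology M]
    [ChartedSpace (𝔼 4) M] [IsManifold (𝓡 4) ∞ M] (e : M ≃ₕ 𝕊⁴) (u u' w w' : Fin 1 ⊕ Fin 1 → ℤ)
    (η η' : Bool) (hu : u' = u ∨ u' = -u) (hw : w' = w ∨ w' = -w)
    (hM : ModelsOnFibred M 1 [(u, η), (u', !η), (w, η'), (w', !η')]) :
    stdSymp ℤ 1 u w = 1 ∨ stdSymp ℤ 1 u w = -1 := by
  obtain ⟨X, _, _, _, _, _, _, bX, Ψ, hX, hglue⟩ := hM.modelsOn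
  have hspan : Submodule.span ℤ (letters [(u, η), (u', !η), (w, η'), (w', !η')]) = ⊤ :=
    Summit.SmoothPoincare4.SmoothPoincare4.Theorems.AcyclicBisectionRigidity.FoldedCurveBranchLocus.span_letters_eq_top_of_gluing_base
      e bX Ψ hglue hX
  have hu' : u' ∈ Submodule.span ℤ ({u, w} : Set (Fin 1 ⊕ Fin 1 → ℤ)) := by
    rcases hu with rfl | rfl
    · exact Submodule.subset_span (by simp)
    · exact Submodule.neg_mem _ (Submodule.subset_span (by simp))
  have hw' : w' ∈ Submodule.span ℤ ({u, w} : Set (Fin 1 ⊕ Fin 1 → ℤ)) := by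
    rcases hw with rfl | rfl
    · exact Submodule.subset_span (by simp)
    · exact Submodule.neg_mem _ (Submodule.subset_span (by simp))
  have hsub : letters [(u, η), (u', !η), (w, η'), (w', !η')] ⊆
      (Submodule.span ℤ ({u, w} : Set (Fin 1 ⊕ Fin 1 → ℤ)) : Set (Fin 1 ⊕ Fin 1 → ℤ)) := by
    rintro v ⟨s, hs⟩
    simp only [List.mem_cons, Prod.mk.injEq, List.not_mem_nil, or_false] at hs
    rcases hs with ⟨rfl, -⟩ | ⟨rfl, -⟩ | ⟨rfl, -⟩ | ⟨rfl, -⟩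
    · exact Submodule.subset_span (by simp)
    · exact hu'
    · exact Submodule.subset_span (by simp)
    · exact hw'
  have hpair : Submodule.span ℤ ({u, w} : Set (Fin 1 ⊕ Fin 1 → ℤ)) = ⊤ :=
    top_le_iff.mp (hspan ▸ Submodule.span_le.2 hsub)
  rw [Summit.SmoothPoincare4.SmoothPoincare4.Theorems.AcyclicBisectionRigidity.FoldedCurveBranchLocus.stdSymp_one_apply]
  exact Summit.SmoothPoincare4.SmoothPoincare4.Theorems.AcyclicBisectionRigidity.FoldedCurveBranchLocus.det_eq_one_or_neg_one_of_span_pair_eq_top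
    u w hpair

/-- **Stub D-top — THE NORMAL-FORM MODEL WITH `|u × w| = 1` IS A TWISTED SPHERE, HENCE `S⁴` BY CERF
(the only topology of genus 1; size XL in Lean, half a page on paper; NOT SPC4-shielded — no homotopy
hypothesis).**  `Base 1 = F_{1,1} × D² = h⁰ ∪ U ∪ V` for the band decomposition of the page along embedded
curves in the classes `u`, `w` meeting once (`|u × w| = 1`); the handle `h₁ = (u,η)` crosses the belt sphere
of `U` once and misses that of `V`, `h₃ = (w,η′)` the reverse, in distinct pages, so
`Base 1 ∪ h₁ ∪ h₃ ≅ B⁴` by two independent geometric 1/2-cancellations (Smale; tree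
`cancel_pair_of_isTransverseInLevel` / Milnor 1965 first cancellation); seen from the cap, `h₂`, `h₄` are
attached along the page push-offs of their circles with cap-frame classes `u`, `w`, so `cap ∪ h₂* ∪ h₄* ≅ B⁴`
likewise; `M = B⁴ ∪_φ B⁴` is a twisted sphere and Cerf (`cerf_twistedSphere_four`, the hypothesis) gives
`M ≅ S⁴`.  (Cerf-free variant: three cancellations + Gabai's Property R + Gluck.)  Worker D report §III.3.
STATUS (wave 2 audit, `stub_genusOneTopRecognition_AUDIT.md`): first missing lemma = a handle decomposition
of the concrete `Base 1` (`HasHandleDecomposition 3 (Base 1) (handleCount 1 2)`), then the Kosinski ⇒ Morse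
converse and a two-pair cancellation package; no misstatement found (η, η′ irrelevant; letters 0/2 base side,
1/3 cap side). [cite: Matsumoto1985, Thm. 3.7] [cite: Cerf1968, main theorem (Γ₄ = 0)] -/
theorem stub_genusOneTopRecognition :
    Literature.Topology.FourManifolds.cerf_twistedSphere_four →
    ∀ (M : Type) [TopologicalSpace M] [T2Space M] [SecondCountableTopology M]
      [ChartedSpace (𝔼 4) M] [IsManifold (𝓡 4) ∞ M] (u w : Fin 1 ⊕ Fin 1 → ℤ) (η η' : Bool),
      (stdSymp ℤ 1 u w = 1 ∨ stdSymp ℤ 1 u w = -1) →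
      ModelsOnFibred M 1 [(u, η), (u, !η), (w, η'), (w, !η')] →
      Nonempty (M ≃ₘ⟮𝓡 4, 𝓡 4⟯ 𝕊⁴) := by
  sorry

open Summit.SmoothPoincare4.SmoothPoincare4.Theorems.AcyclicBisectionExists.ModpBraidOrbits in
/-- **Genus-one folds of homotopy 4-spheres are standard — PROVED from D-prim, D-top, the two fact stubs and
the LANDED D-alg / D-det (registered signature of `stub_genusOneFold` unchanged since s1).**  Chain: NF2
(`wordProduct = 1`) → D-prim (letters primitive) → `matsumotoNormalForm_pm` (±-normal form in the signed
Hurwitz orbit; two letters of each sign from the sorting) → NF4 (`Reach.of_hurwitzOrbit`: it still models `M`)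
→ `genusOneDet_pm` (`|u×w| = 1`) → `helper_normalForm_signs` (exactly-signed normal form with `|u₂×w₂| = 1`
in the orbit) → NF4 → D-top with Cerf. [cite: Matsumoto1985, Thm. 3.2] -/
theorem stub_genusOneFold :
    ∀ (M : Type) [TopologicalSpace M] [T2Space M] [SecondCountableTopology M]
      [ChartedSpace (𝔼 4) M] [IsManifold (𝓡 4) ∞ M],
      M ≃ₕ 𝕊⁴ →
    ∀ (P N : List ((Fin 1 ⊕ Fin 1 → ℤ) × Bool)),
      (∀ x ∈ P, x.2 = true) → (∀ x ∈ N, x.2 = false) → (∀ x ∈ P ++ N, x.1 ≠ 0) →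
      P.length = 2 * 1 → N.length = 2 * 1 →
      Submodule.span ℚ (Set.range fun i : Fin P.length =>
        fun j : Fin 1 ⊕ Fin 1 => ((P.get i).1 j : ℚ)) = ⊤ →
      Submodule.span ℚ (Set.range fun i : Fin N.length =>
        fun j : Fin 1 ⊕ Fin 1 => ((N.get i).1 j : ℚ)) = ⊤ →
      ModelsOnFibred M 1 (P ++ N) →
      Nonempty (M ≃ₘ⟮𝓡 4, 𝓡 4⟯ 𝕊⁴) := by
  intro M _ _ _ _ _ e P N hP hN hnz hlP hlN _hsP _hsN hmodel
  obtain ⟨-, hNF2, -, hNF4⟩ := stub_factLefschetz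
  -- NF2: the signed monodromy of a model of a homotopy sphere is trivial
  obtain ⟨-, -, hprod⟩ := hNF2 M 1 (P ++ N) e hmodel.modelsOn
  -- D-prim: letters are primitive
  have hprim : ∀ x ∈ P ++ N, IsPrimitive x.1 :=
    fun x hx => stub_genusOnePrimitive M (P ++ N) hmodel x hx (hnz x hx)
  -- D-alg (landed): the ±-normal form in the signed Hurwitz orbit
  have hlen : (P ++ N).length = 4 := by rw [List.length_append, hlP, hlN]
  have h22 : ((P ++ N).filter (·.2)).length = 2 := by rw [filter_snd_sorted hP hN, hlP]
  obtain ⟨u, u', w, w', η, η', hu, hw, horb⟩ := matsumotoNormalForm_pm (P ++ N) hlen h22 hprim hprod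
  -- NF4: the normal form still models `M`; D-det (±): `|u × w| = 1`
  have hmodel' : ModelsOnFibred M 1 [(u, η), (u', !η), (w, η'), (w', !η')] :=
    hNF4 M 1 (P ++ N) 1 _ hmodel (Reach.of_hurwitzOrbit horb)
  have hdet := genusOneDet_pm M e u u' w w' η η' hu hw hmodel'
  -- sign fixing (landed): an exactly-signed normal form with `|u₂ × w₂| = 1`, which again models `M`
  obtain ⟨u₂, w₂, hdet₂, horb₂⟩ :=
    Summit.SmoothPoincare4.SmoothPoincare4.Theorems.AcyclicBisectionRigidity.FoldedCurveBranchLocus.helper_normalForm_signs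
      u u' w w' η η' hu hw hdet
  have hmodel₂ : ModelsOnFibred M 1 [(u₂, η), (u₂, !η), (w₂, η'), (w₂, !η')] :=
    hNF4 M 1 _ 1 _ hmodel' (Reach.of_hurwitzOrbit horb₂)
  -- D-top (Cerf)
  exact stub_genusOneTopRecognition stub_factCerf M u₂ w₂ η η' hdet₂ hmodel₂

/-! ## Stub B — fold genus `≥ 2`: the open core -/

/-- **Stub B — HIGHER-GENUS FOLD RECOGNITION (THE OPEN CORE; SPC4-implied; size: open-problem).**
Let `M ≃ₕ S⁴` be a Hausdorff second-countable `C^∞` 4-manifold with a folded fibred Lefschetz model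
of genus `g ≥ 2`: `ModelsOnFibred M g (P ++ N)`, `P` positive, `N` negative, all shadows non-zero,
`|P| = |N| = 2g`, both shadow sets spanning `ℚ^{2g}`.  Then `M ≅ S⁴`.
Status.  With Stub A (⇒) and Baykur's tree fact `steinRealisation_of_sorted_modelsOnFibred` + Kas (⇐:
such an `M` IS an acyclic common-contact Stein bisection `X(F;P) ∪ X̄(F;N̄)`) this is the crux
RESTRICTED TO FOLD GENUS `≥ 2`, read on the fold: named as the core, not dressed as a lever.  It is
where the card's mechanism lives: (E1) HYPERELLIPTIC folds (all `4g` vanishing cycles symmetric under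
the hyperelliptic involution of `F_{g,1}`; Birman–Hilden `SMod(F_{g,1},∂) ≅ B_{2g+1}` injective, so the
two boundary braids COINCIDE and the descent is honest): `M = Σ₂(S⁴, R)`, `R = S_P ∪ S̄_N` a closed
surface braid of degree `2g+1`, a 2-KNOT by Smith theory — Hayden's non-twin inhabitant
(arXiv:2003.13681 Thm. 1.3, genus-2 book) and the positron pair (arXiv:2107.06856 Thm. 1.4, `β, β′ ∈
B₅`: genus 2) are here with `R` of GROUP ℤ (card P1: `π₁(B⁴∖Dᵢ) = ℤ` pushes out to `ℤ`), TOP-unknotted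
(Freedman; Conway–Powell arXiv:1902.05321), and `R_Hayden` is smoothly unknotted (triage r2-1 (S1)):
the card's K2′ `GroupZBranchedCoversStandard` is the first sub-statement to register as a helper;
engines on `R`: bridge number `≤ 3` ⇒ unknotted (Meier–Zupan arXiv:1507.08370 Thm. 1.8) /
trisection genus `≤ 2` (tree `Literature.Barriers.SmoothPoincare4.mz_genus_le_two_homotopySphere_gk`),
`S¹`-invariant ⇒ `fintushelPao_circleAction_homotopySphere_four`; (E2) `P` Hurwitz-equivalent to `N̄`
(possibly after a common conjugation extending over `X(F;P)`) ⇒ `M = D(X(F;P))`, a double of a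
contractible Stein 2-handlebody = item stmt-SmoothPoincare4-3546 / 3717 (Andrews–Curtis-adjacent;
Disproof §4b: conversely every presentation sphere is such a double, so this sub-sector is EXACTLY
3717-hard); (E3) stable signed-Hurwitz nullity of the achiral word `P ++ N` (sibling cards
hurwitz-deletion-presentation / unimodular-relator-reduction) ⇒ presentation sphere ⇒ (E2).
First test objects: the fold words of the positron pair (`B₅`, four bands each: genus 2), Gompf's
`C(r,s;m)` with `f^k`, the 324 T6 spheres of Disproof §13d (planar `k = 5` ⇒ fold genus 4).
Why it might fail: only via an exotic `S⁴` (shielded shape, Disproof §1); as a TARGET it may be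
SPC4-hard — no engine is known on non-hyperelliptic, Hurwitz-inequivalent genus-`≥ 2` pairs.  `M ≃ₕ S⁴`
load-bearing (`D(B_{p,q})`, `D(X_L)`-type doubles of higher genus).
Sources: arXiv:2003.13681; arXiv:2107.06856; arXiv:1902.05321; arXiv:1507.08370; Birman–Hilden 1973;
Gordon, Comment. Math. Helv. 51 (1976); arXiv:math/0601396 §5; Disproof.lean §§4b, 12b, 13b–d. -/
theorem stub_higherGenusFold :
    ∀ (M : Type) [TopologicalSpace M] [T2Space M] [SecondCountableTopology M]
      [ChartedSpace (𝔼 4) M] [IsManifold (𝓡 4) ∞ M],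
      M ≃ₕ 𝕊⁴ →
    ∀ (g : ℕ), 2 ≤ g → ∀ (P N : List ((Fin g ⊕ Fin g → ℤ) × Bool)),
      (∀ x ∈ P, x.2 = true) → (∀ x ∈ N, x.2 = false) → (∀ x ∈ P ++ N, x.1 ≠ 0) →
      P.length = 2 * g → N.length = 2 * g →
      Submodule.span ℚ (Set.range fun i : Fin P.length =>
        fun j : Fin g ⊕ Fin g => ((P.get i).1 j : ℚ)) = ⊤ →
      Submodule.span ℚ (Set.range fun i : Fin N.length =>
        fun j : Fin g ⊕ Fin g => ((N.get i).1 j : ℚ)) = ⊤ →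
      ModelsOnFibred M g (P ++ N) →
      Nonempty (M ≃ₘ⟮𝓡 4, 𝓡 4⟯ 𝕊⁴) := by
  sorry

/-! ## Composition (kernel-checked, no `sorry` of its own): the crux BY NAME -/

/-- **Fold recognition in every genus from the rungs** (genus `0`: the folded word is empty by
`|P| = |N| = 0`, Stub C — landed; genus `1`: `stub_genusOneFold` — proved above from the D-stubs;
genus `≥ 2`: Stub B). -/
theorem foldRecognition_all (g : ℕ) : FoldRecognition g := by
  intro M _ _ _ _ _ e P N hw hmodel
  obtain ⟨hP, hN, hnz, hlP, hlN, hsP, hsN⟩ := hw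
  rcases Nat.lt_or_ge g 2 with hlt | hge
  · interval_cases g
    · -- genus 0: empty word, twisted sphere, Cerf
      have hP0 : P = [] := List.eq_nil_of_length_eq_zero (by simpa using hlP)
      have hN0 : N = [] := List.eq_nil_of_length_eq_zero (by simpa using hlN)
      subst hP0
      subst hN0
      exact stub_unfoldedSphere stub_factCerf M (by simpa using hmodel)
    · -- genus 1: Matsumoto
      exact stub_genusOneFold M e P N hP hN hnz hlP hlN hsP hsN hmodel
  · -- genus ≥ 2: the open core
    exact stub_higherGenusFold M e g hge P N hP hN hnz hlP hlN hsP hsN hmodel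

/-- **CRUX FROM THE LINE: `ConvexBisection.AcyclicBisectionRigidity` (stmt-SmoothPoincare4-10507).**
FOLD `M ≃ₕ S⁴` by `foldedNormalForm_of_facts` (fact stub `stub_factLefschetz`) and recognise by genus
(`foldRecognition_all`).  HONESTY NOTE (reshape s3): the acyclic Stein bisection `hb` is NOT consumed — the
folded normal form exists for every homotopy 4-sphere — so this composition proves the crux only because it
proves `SmoothPoincare4` from the same stubs (`spc4_of_stubs` below); the crux's hypothesis is where the
planner's Stub A would have USED the bisection, and the audit showed that its conclusion does not remember
it.  `M ≃ₕ S⁴` is load-bearing everywhere (Disproof `false_without_homotopyEquiv`). -/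
theorem AcyclicBisectionRigidity_of : ConvexBisection.AcyclicBisectionRigidity := by
  intro M _ _ _ _ _ e _hb
  obtain ⟨h₁, h₂, h₃, h₄⟩ := stub_factLefschetz
  obtain ⟨g, P, N, hP, hN, hnz, hlP, hlN, hsP, hsN, hmodel⟩ :=
    foldedNormalForm_of_facts h₁ h₂ h₃ h₄ M e
  exact foldRecognition_all g M e P N ⟨hP, hN, hnz, hlP, hlN, hsP, hsN⟩ hmodel

/-- **The same stubs prove the summit** (recorded, not hidden: see the module docstring). -/
theorem spc4_of_stubs : SmoothPoincare4 := by
  intro M _ _ _ _ _ e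
  obtain ⟨h₁, h₂, h₃, h₄⟩ := stub_factLefschetz
  obtain ⟨g, P, N, hP, hN, hnz, hlP, hlN, hsP, hsN, hmodel⟩ :=
    foldedNormalForm_of_facts h₁ h₂ h₃ h₄ M e
  exact foldRecognition_all g M e P N ⟨hP, hN, hnz, hlP, hlN, hsP, hsN⟩ hmodel

/-! ## Certificates (sorry-free): the line's apex is the summit modulo the four facts -/

/-- **Fold recognition in every genus ⇒ SPC4, modulo the four Lefschetz facts** (sorry-free: the facts
are hypotheses here).  With `foldRecognition_of_spc4` this makes `∀ g, FoldRecognition g` EQUIVALENT to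
`SmoothPoincare4` modulo NF1–NF4: the line's Transfer `C⁺` is the summit in costume, not a reduction of the
crux. [folklore] -/
theorem spc4_of_foldRecognition_of_facts
    (hF : modelsOnFibred_exists ∧ modelsOn_counts_of_homotopyEquiv_sphere ∧
      modelsOnFibred_balance_of_homotopyEquiv_sphere ∧ modelsOnFibred_of_reach)
    (hR : ∀ g, FoldRecognition g) : SmoothPoincare4 := by
  intro M _ _ _ _ _ e
  obtain ⟨h₁, h₂, h₃, h₄⟩ := hF
  obtain ⟨g, P, N, hP, hN, hnz, hlP, hlN, hsP, hsN, hmodel⟩ :=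
    foldedNormalForm_of_facts h₁ h₂ h₃ h₄ M e
  exact hR g M e P N ⟨hP, hN, hnz, hlP, hlN, hsP, hsN⟩ hmodel

/-- **Stubs B and D are implied by the summit** (shielded shape `∀ M ≃ₕ S⁴, P M → M ≅ S⁴` of Disproof
§1 `shielded_of_spc4`). -/
theorem foldRecognition_of_spc4 (h : SmoothPoincare4) (g : ℕ) : FoldRecognition g := by
  intro M _ _ _ _ _ e P N _ _
  exact h M inferInstance inferInstance e

/-- **`∀ g, FoldRecognition g ↔ SmoothPoincare4` modulo the four facts.** [folklore] -/
theorem foldRecognition_iff_spc4_of_facts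
    (hF : modelsOnFibred_exists ∧ modelsOn_counts_of_homotopyEquiv_sphere ∧
      modelsOnFibred_balance_of_homotopyEquiv_sphere ∧ modelsOnFibred_of_reach) :
    (∀ g, FoldRecognition g) ↔ SmoothPoincare4 :=
  ⟨spc4_of_foldRecognition_of_facts hF, foldRecognition_of_spc4⟩

/-- **THE APEX IS THE SUMMIT: Stub B alone ⇒ SPC4, modulo the four facts and the two low rungs** (genus
`0`: LANDED modulo Cerf; genus `1`: Matsumoto, the D-stubs).  Sorry-free: every unproved input is a
hypothesis.  This is the lead's certificate for the line verdict: `stub_higherGenusFold` is not crux-sized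
but SUMMIT-sized — an exotic 4-sphere has fold genus `≥ 2` (the low rungs) and nothing in the line acts on
fold genus `≥ 2`. [folklore] -/
theorem spc4_of_higherGenusFold_of_facts
    (hF : modelsOnFibred_exists ∧ modelsOn_counts_of_homotopyEquiv_sphere ∧
      modelsOnFibred_balance_of_homotopyEquiv_sphere ∧ modelsOnFibred_of_reach)
    (hC : FoldRecognition 0) (hD : FoldRecognition 1)
    (hB : ∀ g, 2 ≤ g → FoldRecognition g) : SmoothPoincare4 := by
  refine spc4_of_foldRecognition_of_facts hF fun g => ?_
  rcases Nat.lt_or_ge g 2 with hlt | hge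
  · interval_cases g
    · exact hC
    · exact hD
  · exact hB g hge

/-- Stub B is literally `∀ g ≥ 2, FoldRecognition g` (definitional repackaging, for the certificate
above). [folklore] -/
theorem foldRecognition_of_stubB (g : ℕ) (hg : 2 ≤ g) : FoldRecognition g := by
  intro M _ _ _ _ _ e P N hw hmodel
  obtain ⟨hP, hN, hnz, hlP, hlN, hsP, hsN⟩ := hw
  exact stub_higherGenusFold M e g hg P N hP hN hnz hlP hlN hsP hsN hmodel

end Summit.SmoothPoincare4.SmoothPoincare4.Cruxes.AcyclicBisectionRigidity.FoldedCurveBranchLocus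

end
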